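import Literature.AlgebraicGeometry.Hyperkaehler.ThirdCohomologyKugaSatake
import Literature.AlgebraicGeometry.Motives.HodgeStructureIrreducibleDecomposition
import HarnessLib

/-!
# Consistency of the two records on `H³` of a `Kumⁿ`-type variety: O'Grady's «`KS(X, L) ~ J³(X)⁴`» (ρ = 1) implies the conclusion of Voisin's Thm. 1.3 (2) «`J³(X) ⊇` a simple Kuga–Satake factor» — THEOREMS ONLY

[topic AlgebraicGeometry/Hyperkaehler]

Layer `Literature/AlgebraicGeometry/Hyperkaehler`; cross-ladder literature-typing layer (D-0088(4), LT-H4, seat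
`hodge-lit-oqh-1` gen 3). No definition of record, no named fact (net debt `0`): a PROVED kernel lemma tying
together the two named facts of `Hyperkaehler/ThirdCohomologyKugaSatake` (landed p465239),

* `OGrady2021_kugaSatake_kummerType_fourthPower_thirdCohomology` — O'Grady IMRN 2021 Thm. 1.5 / Voisin
  Math. Z. 300 (2022) Thm. 3.2 at `ρ(X) = 1`: a `ℚ`-isomorphism `θ : C⁺(P) ≃ (Fin 4 → H³(X, ℚ))` carrying the
  Kuga–Satake filtration of `(H²_tr, q_X)` onto that of `H³(X, ℚ)(1)^{⊕4}` (`HodgeStructure.pi`);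
* `Voisin2022_thirdCohomology_kugaSatakeFactor` — Voisin Thm. 1.3 (2): an IRREDUCIBLE sub-Hodge structure
  `W` of the Kuga–Satake structure with an INJECTIVE morphism `W → H³(X, ℚ)(1)`,

in the direction print states (Voisin 2022 §3, p. 7: Thm. 3.2 is the generalized-Kummer case of
Thm. 1.3 (2); "`J³(X)` […] contains a simple component of the Kuga–Satake abelian variety"): FROM O'Grady's
`ρ = 1` statement, the CONCLUSION of Thm. 1.3 (2) follows for the same data `(X, b, M, T, H, P, j)` — by pure
Hodge-structure algebra: `C⁺(P)` is a non-zero finite-dimensional `ℚ`-Hodge structure (`dim_ℚ T = 6`), so it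
has an irreducible sub-Hodge structure `W` (`SubHodgeStructure.exists_le_isIrreducible`); composing
`W ↪ C⁺(P) →θ H³(1)^{⊕4} → H³(1)` with the four coordinate projections gives four morphisms `W → H³(X, ℚ)(1)`
whose kernels are sub-Hodge structures of `W` (`Hom.exists_subHodgeStructure_ker`), hence `0` or `W`; they
cannot all be `W` because `θ ∘ (W ↪ C⁺)` is injective and `W ≠ 0`, so one of them is injective.  Nothing
here asserts either record; HONEST FRAMING: typed ≠ proved ≠ endorsed, and the hypothesis of
`….exists_isIrreducible_hom_injective` IS O'Grady's record taken as `(h : …)`.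

## References

* [Voisin2022FootnotesOGradyMarkman] C. Voisin, Math. Z. 300 (2022), Thm. 1.3 (2), Thm. 3.2 and §3 p. 7.
* [OGrady2021KummerTori] K. G. O'Grady, IMRN 2021, Thm. 1.5.
* [VoisinHodgeI2002] C. Voisin, Hodge Theory I, §7.3.1 (morphisms, kernels, sub-Hodge structures).
* [Huybrechts2016K3] D. Huybrechts, Lectures on K3 surfaces, §3.3.3 (irreducible sub-Hodge structures exist).
-/

noncomputable section

open CategoryTheory
open scoped TensorProduct

namespace Literature.AlgebraicGeometry.Hyperkaehler

open Literature.AlgebraicTopology.SingularHomology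
open Literature.AlgebraicGeometry.HodgeTheory
open Motives (SchemeOver IsSmoothProjective bettiCohomology HodgeStructure)
open Motives.HodgeStructure (SubHodgeStructure)

/-! ## Two morphisms of Hodge structures (plumbing, existence form — theorems only) -/

section Plumbing

universe u v w

/-- **The coordinate projections of a finite direct sum of Hodge structures are morphisms**
(`F^p(⊕ W_j) = ⊕ F^p W_j`, Deligne Hodge II 2.1): there is a morphism `⊕ⱼ Hⱼ → Hⱼ` with underlying map
the `j`-th projection. [cite: DeligneHodgeII1971, 2.1] -/
theorem exists_hom_pi_proj {ι : Type w} [Fintype ι] [DecidableEq ι] {W : ι → Type v}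
    [∀ j, AddCommGroup (W j)] [∀ j, Module ℚ (W j)] {m : ℤ} (H : ∀ j, HodgeStructure (W j) m) (j : ι) :
    ∃ g : (HodgeStructure.pi H).Hom (H j), g.toLinearMap = LinearMap.proj j :=
  ⟨{ toLinearMap := LinearMap.proj j
     map_F_le := fun p ↦ by
       rintro _ ⟨x, hx, rfl⟩
       rw [HodgeStructure.proj_baseChange_apply]
       exact (HodgeStructure.mem_pi_F_iff H).1 hx j }, rfl⟩

/-- **A `ℚ`-linear isomorphism carrying one Hodge filtration onto another underlies a morphism of Hodge
structures** (indeed an isomorphism; only the forward morphism is needed here).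
[cite: VoisinHodgeI2002, §7.3.1] -/
theorem exists_hom_of_filtration_eq {V : Type u} [AddCommGroup V] [Module ℚ V] {V' : Type v}
    [AddCommGroup V'] [Module ℚ V'] {m : ℤ} (H₁ : HodgeStructure V m) (H₂ : HodgeStructure V' m)
    (θ : V ≃ₗ[ℚ] V') (hθ : ∀ p : ℤ, (H₁.F p).map (θ.toLinearMap.baseChange ℂ) = H₂.F p) :
    ∃ g : H₁.Hom H₂, g.toLinearMap = θ.toLinearMap :=
  ⟨{ toLinearMap := θ.toLinearMap, map_F_le := fun p ↦ (hθ p).le }, rfl⟩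

/-- **An irreducible Hodge structure embedded in a finite direct sum `⊕ⱼ Hⱼ` injects into some summand**:
for `H₀` irreducible and `g : H₀ → ⊕ⱼ Hⱼ` an injective morphism, some coordinate `H₀ → Hⱼ` is an injective
morphism (its kernel underlies a sub-Hodge structure of `H₀` — `Hom.exists_subHodgeStructure_ker` —, hence is
`0` or everything; not all coordinates vanish on `H₀ ≠ 0`).
[cite: VoisinHodgeI2002, §7.3.1 Lemma 7.25] [cite: Huybrechts2016K3, §3.3.3] -/
theorem exists_hom_injective_of_isIrreducible_of_hom_pi {ι : Type w} [Fintype ι] [DecidableEq ι]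
    {W : ι → Type v} [∀ j, AddCommGroup (W j)] [∀ j, Module ℚ (W j)] {m : ℤ}
    (H : ∀ j, HodgeStructure (W j) m) {U : Type u} [AddCommGroup U] [Module ℚ U] {H₀ : HodgeStructure U m}
    (hirr : H₀.IsIrreducible) (g : H₀.Hom (HodgeStructure.pi H)) (hg : Function.Injective g.toLinearMap) :
    ∃ (j : ι) (f : H₀.Hom (H j)), Function.Injective f.toLinearMap := by
  choose π hπ using exists_hom_pi_proj H
  by_contra hcon
  push Not at hcon
  -- every coordinate morphism `π j ∘ g` vanishes identically
  have hzero : ∀ j (u : U), ((π j).comp g).toLinearMap u = 0 := by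
    intro j u
    obtain ⟨K, hK⟩ := ((π j).comp g).exists_subHodgeStructure_ker
    rcases hirr.2 K with h0 | h1
    · exact absurd (LinearMap.ker_eq_bot.1 (hK ▸ h0)) (hcon j _)
    · have hu : u ∈ LinearMap.ker ((π j).comp g).toLinearMap := by
        rw [← hK, h1]
        exact Submodule.mem_top
      exact hu
  -- hence `g = 0`, contradicting injectivity on the non-zero `U`
  haveI := hirr.1
  obtain ⟨u, hu⟩ := exists_ne (0 : U)
  refine hu (hg ?_)
  rw [map_zero]
  funext j
  have h := hzero j u
  change (π j).toLinearMap (g.toLinearMap u) = 0 at h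
  rw [hπ] at h
  exact h

end Plumbing

/-! ## O'Grady's `ρ = 1` record ⟹ the conclusion of Voisin's Thm. 1.3 (2) -/

/-- **Consistency (Voisin 2022 §3: Thm. 3.2 is the `Kumⁿ` case of Thm. 1.3 (2)).**  From O'Grady's record
`OGrady2021_kugaSatake_kummerType_fourthPower_thirdCohomology` (`θ : C⁺(P) ≃ H³(X, ℚ)^{⊕4}` carrying the
Kuga–Satake filtration onto that of `H³(X, ℚ)(1)^{⊕4}`), for every `2 ≤ n`, every smooth projective `Kumⁿ`-type
`X`, Fujiki form `b`, Hodge-symmetric model `M` and presentation `(T, H, P, j)` of `(H²_tr(X, ℚ), q_X)` with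
`h^{2,0}(T) = 1` and `dim_ℚ T = 6` (`ρ(X) = 1`): the Kuga–Satake Hodge structure on `C⁺(P)` has an
IRREDUCIBLE sub-Hodge structure `W` with an INJECTIVE morphism `W → H³(X, ℚ)(1)` — literally the conclusion
of `Voisin2022_thirdCohomology_kugaSatakeFactor` for these data ("`J³(X)` contains a simple component of the
Kuga–Satake abelian variety").  Proof: module docstring (`C⁺(P) ≠ 0` finite-dimensional ⟹ an irreducible
`W` exists; one of the four coordinates of `θ|_W` is injective).
[cite: Voisin2022FootnotesOGradyMarkman, Thm. 1.3 (2), Thm. 3.2 and §3 (p. 7)] [cite: OGrady2021KummerTori, Thm. 1.5] -/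
theorem OGrady2021_kugaSatake_kummerType_fourthPower_thirdCohomology.exists_isIrreducible_hom_injective
    (h : OGrady2021_kugaSatake_kummerType_fourthPower_thirdCohomology) {n : ℕ} (hn : 2 ≤ n)
    {X : SchemeOver ℂ} (hX : IsSmoothProjective (2 * n) X) (hK : IsOfGeneralizedKummerType n X)
    {b : complexBetti X 2 →ₗ[ℂ] complexBetti X 2 →ₗ[ℂ] ℂ} (hb : IsFujikiForm n X b)
    (M : HodgeModel (2 * n) X) (hM : M.IsHodgeSymmetric)
    {T : Type} [AddCommGroup T] [Module ℚ T] {H : HodgeStructure T 2} {P : H.Polarization}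
    (hT : H.hodgeNumber 2 0 = 1) {j : H.Hom (bettiTwoHodgeStructureOfModel hX M hM)}
    (hj : IsTranscendentalPartHK hX M hM b H P j) (h6 : Module.finrank ℚ T = 6) :
    ∃ W : (H.kugaSatake P hT).SubHodgeStructure, W.toHodgeStructure.IsIrreducible ∧
      ∃ f : W.toHodgeStructure.Hom (bettiThreeTwistOne hX M hM), Function.Injective f.toLinearMap := by
  obtain ⟨θ, hθ⟩ := h n hn X hX hK b hb M hM T H P hT j hj h6
  -- `C⁺(P)` is a non-zero finite-dimensional `ℚ`-space
  haveI : Module.Finite ℚ T := Module.finite_of_finrank_eq_succ h6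
  haveI : Module.Finite ℚ (CliffordAlgebra.even P.quadraticForm) := inferInstance
  have htop : (⊤ : (H.kugaSatake P hT).SubHodgeStructure).toSubmodule ≠ ⊥ := by
    rw [HodgeStructure.SubHodgeStructure.toSubmodule_top]
    haveI : Nontrivial (CliffordAlgebra.even P.quadraticForm) :=
      ⟨⟨0, 1, fun h01 ↦ zero_ne_one (congrArg Subtype.val h01)⟩⟩
    exact top_ne_bot
  -- an irreducible sub-Hodge structure `W` of the Kuga–Satake structure
  obtain ⟨W, -, hW⟩ := HodgeStructure.SubHodgeStructure.exists_le_isIrreducible _ htop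
  -- `W ↪ C⁺(P) ≃ H³(1)^{⊕4}`, an injective morphism
  obtain ⟨g₀, hg₀⟩ :=
    exists_hom_of_filtration_eq _ (HodgeStructure.pi fun _ : Fin 4 ↦ bettiThreeTwistOne hX M hM) θ hθ
  have hg : Function.Injective (g₀.comp W.subtypeHom).toLinearMap := by
    change Function.Injective (g₀.toLinearMap ∘ₗ W.subtypeHom.toLinearMap)
    rw [hg₀, LinearMap.coe_comp]
    exact θ.injective.comp (HodgeStructure.SubHodgeStructure.subtypeHom_injective W)
  obtain ⟨-, f, hf⟩ := exists_hom_injective_of_isIrreducible_of_hom_pi _ hW (g₀.comp W.subtypeHom) hg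
  exact ⟨W, hW, f, hf⟩

/-- **Corollary (the two records agree at `ρ = 1`)**: O'Grady's record gives, for `Kumⁿ`-type `X` with a
presentation of `H²_tr` of `ℚ`-dimension `6`, exactly the `∃ W, ∃ f` statement that Voisin's Thm. 1.3 (2)
record asserts for every projective irreducible symplectic `X` with `b₃ ≠ 0` — here read off for an `X` that is
ALSO given as projective irreducible symplectic (smoothness witness `hX.1`).
[cite: Voisin2022FootnotesOGradyMarkman, Thm. 1.3 (2) and Thm. 3.2] -/
theorem OGrady2021_kugaSatake_kummerType_fourthPower_thirdCohomology.thirdCohomology_kugaSatakeFactor_of_finrank_eq_six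
    (h : OGrady2021_kugaSatake_kummerType_fourthPower_thirdCohomology) {n : ℕ} (hn : 2 ≤ n)
    {X : SchemeOver ℂ} (hX : IsProjectiveIrreducibleSymplectic (2 * n) X) (hK : IsOfGeneralizedKummerType n X)
    {b : complexBetti X 2 →ₗ[ℂ] complexBetti X 2 →ₗ[ℂ] ℂ} (hb : IsFujikiForm n X b)
    (M : HodgeModel (2 * n) X) (hM : M.IsHodgeSymmetric)
    {T : Type} [AddCommGroup T] [Module ℚ T] {H : HodgeStructure T 2} {P : H.Polarization}
    (hT : H.hodgeNumber 2 0 = 1) {j : H.Hom (bettiTwoHodgeStructureOfModel hX.1 M hM)}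
    (hj : IsTranscendentalPartHK hX.1 M hM b H P j) (h6 : Module.finrank ℚ T = 6) :
    ∃ W : (H.kugaSatake P hT).SubHodgeStructure, W.toHodgeStructure.IsIrreducible ∧
      ∃ f : W.toHodgeStructure.Hom (bettiThreeTwistOne hX.1 M hM), Function.Injective f.toLinearMap :=
  h.exists_isIrreducible_hom_injective hn hX.1 hK hb M hM hT hj h6

end Literature.AlgebraicGeometry.Hyperkaehler

end
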